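import Literature.Geometry.Symplectic.StandardEnd
import Literature.Topology.FourManifolds.HomotopySpheres
import Literature.Topology.FourManifolds.TwistedSpheres
import Literature.Topology.FourManifolds.CerfGammaFour
import HarnessLib

/-!
# Gromov–McDuff: a homotopy 4-sphere symplectic and standard near a puncture is a twisted sphere

Named fact (D-0014) requested by route SmoothPoincare4/SymplecticCap (`wi-04053`, the
"twisted-sphere form" of the route's Gromov–McDuff fact), stated over the tree's
`Literature.HomotopySphere 4` (`HomotopySpheres.lean`), `Literature.Geometry.Symplectic.punctured` /
`Literature.Geometry.Symplectic.IsSymplecticStandardNearPoint` (`StandardEnd.lean`) and `Literature.Topology.FourManifolds.IsTwistedSphere`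
(`TwistedSpheres.lean`).

## The printed results and the derivation being packaged

Let `Σ` be a homotopy 4-sphere, `p ∈ Σ`, and `sf` a symplectic form on `V = Σ ∖ {p}` which on a
punctured chart-ball at `p` is the pullback of `ι*ω₀` (`IsSymplecticStandardNearPoint p ε sf`:
`(V, sf)` is symplectic and *standard at infinity*, the inversion `ι` carrying the punctured
ball onto the complement of a ball in `(ℝ⁴, ω₀)`).

1. (Compactification.) Since `ℝ⁴ ∖ B̄ ⊂ ℂP² ∖ B̄` is a punctured tubular neighbourhood of the line
   at infinity, `Σ̂ = V ∪ ℂP¹` is a closed symplectic 4-manifold containing a symplectic sphere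
   `L = ℂP¹` with `L · L = 1`, and `Σ̂ ∖ L = V` is contractible, hence contains no exceptional
   sphere (the pair `(Σ̂, L)` is *minimal*).
2. (McDuff 1990, Thm. 1.4 with Cor. 1.5 (i), p. 682 — a minimal symplectic pair `(V, C, ω)`,
   `C` a rational curve with `C · C = p ≥ 0`, is `ℂP²` (with `C` a line or a quadric) or a
   symplectic `S²`-bundle, and for `p ≠ 0, 4` the diffeomorphism type of `(V, C)` is determined by
   `p`; equivalently Thm. 1.7, p. 683: minimal fillings of `(L₁, σ) = (S³, σ)` are unique up to
   diffeomorphism. McDuff–Salamon 2012, Thm. 9.4.1; this is the step behind Gromov's recognition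
   of `ℝ⁴`, Gromov 1985 §0.3.C = McDuff–Salamon Thm. 9.4.2. Thm. 1.1 of McDuff 1990 is the
   blowing-down theorem and was cited here by mistake; corrected 2026-08-14 after reading the
   held copy.) A minimal symplectic pair `(M, C)` with `C` an embedded symplectic sphere,
   `C · C = 1`, is symplectomorphic to `(ℂP², λ ω_FS, ℂP¹)` as a pair. Hence a diffeomorphism of
   pairs `(Σ̂, L) ≅ (ℂP², ℂP¹)`.
3. (Hirsch 1976, §4.5, uniqueness of tubular neighbourhoods up to ambient isotopy.) The closed
   chart-ball `B̄` at `p` together with `L` is a closed tubular neighbourhood of `L` in `Σ̂`, so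
   `Σ ∖ B ≅ ℂP² ∖ ν(ℂP¹) ≅ D⁴`; and `B̄ ≅ D⁴`. The two pieces meet along the chart 3-sphere, so
   `Σ = D⁴ ∪_φ D⁴` for the induced boundary diffeomorphism `φ` of `S³`, i.e.
   `IsTwistedSphere 3 φ Σ` (`IsBoundaryGluing` of two `closedBallBoundaryData 3`).

Only the END RESULT of 1–3 is recorded, as the named fact
`gromovMcDuff_isTwistedSphere_of_symplecticStandardNearPoint` (nothing is asserted; users take it
as a hypothesis). It is weaker than the pair statement of step 2 (no symplectic conclusion, no
identification of the pieces), and it is exactly what the route composes with Cerf's `Γ₄ = 0`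
(`Literature.Topology.FourManifolds.cerf_twistedSphere_four`, `CerfGammaFour.lean`) — see the proved corollary
`.nonempty_diffeomorph_sphere`: such a `Σ` is diffeomorphic to `S⁴`.

The instance binder `[Fact (Literature.isSmoothEmbedding_sphereInclusion' 3)]` is the tree's convention
for `closedBallBoundaryData` (`ClosedBall.lean`), as in `cerf_twistedSphere_four`.

## References

* D. McDuff, *The structure of rational and ruled symplectic 4-manifolds*, J. Amer. Math. Soc. 3
  (1990) 679–712, Thm. 1.4, Cor. 1.5 (i), Thm. 1.7 [McDuff1990].
* D. McDuff, D. Salamon, *J-holomorphic curves and symplectic topology*, 2nd ed., AMS Colloquium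
  Publ. 52 (2012), Thm. 9.4.1, Thm. 9.4.2 [McDuffSalamon2012].
* M. Gromov, *Pseudo holomorphic curves in symplectic manifolds*, Invent. Math. 82 (1985)
  307–347, §0.3.C [Gromov1985].
* M. Hirsch, *Differential Topology*, GTM 33 (1976), §4.5 (tubular neighbourhoods) [Hirsch1976].
-/

noncomputable section

open scoped Manifold ContDiff
open TopologicalSpace

namespace Literature.Geometry.Symplectic

/-- The unit 3-sphere `S³ ⊆ ℝ⁴` with Mathlib's smooth structure. [folklore] -/
local notation "𝕊³" => (Metric.sphere (0 : EuclideanSpace ℝ (Fin 4)) 1)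

/-- The round 4-sphere `S⁴ ⊆ ℝ⁵` with Mathlib's smooth structure. [folklore] -/
local notation "𝕊⁴" => (Metric.sphere (0 : EuclideanSpace ℝ (Fin 5)) 1)

/-- **Gromov–McDuff, twisted-sphere form.** Let `Σ` be an (oriented) homotopy 4-sphere
(`Literature.HomotopySphere 4`), `p ∈ Σ`, and `sf` a `2`-form on `Σ ∖ {p}` which is symplectic and equal,
on a punctured chart-ball at `p`, to the pullback of `ι*ω₀` (`IsSymplecticStandardNearPoint p ε sf`).
Then `Σ` is a twisted sphere: `Σ = D⁴ ∪_φ D⁴` for some self-diffeomorphism `φ` of `S³`.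
(Packaging of: compactify the standard end by the line at infinity; McDuff 1990 Thm. 1.4 with
Cor. 1.5 (i) / McDuff–Salamon Thm. 9.4.1 give `(Σ̂, L) ≅ (ℂP², ℂP¹)` as a pair since `Σ ∖ p` is
contractible,
hence minimal — the argument of Gromov 1985 §0.3.C = McDuff–Salamon Thm. 9.4.2; by uniqueness of
tubular neighbourhoods, Hirsch §4.5, `Σ ∖ B ≅ ℂP² ∖ ν(ℂP¹) ≅ D⁴`, glued to the chart-ball
`B̄ ≅ D⁴` along the chart sphere.) Nothing is asserted; users take
`(h : gromovMcDuff_isTwistedSphere_of_symplecticStandardNearPoint)`. PROVED from the single named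
fact `gromov_recognitionR4_relEnd` (Gromov's recognition of `ℝ⁴` relative at infinity) in the
sibling `GromovMcDuffTwistedSphereProofs.lean`
(`gromovMcDuff_isTwistedSphere_of_recognitionR4_relEnd`, with `φ = id`).
[cite: McDuff1990, Thm. 1.4, Cor. 1.5 (i)] [cite: McDuffSalamon2012, Thm. 9.4.1–9.4.2]
[cite: Gromov1985, §0.3.C] [cite: Hirsch1976, §4.5] -/
def gromovMcDuff_isTwistedSphere_of_symplecticStandardNearPoint : Prop :=
  ∀ [Fact (Literature.Topology.FourManifolds.isSmoothEmbedding_sphereInclusion' 3)] (S : Literature.Topology.FourManifolds.HomotopySphere 4) (p : S.carrier)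
    (ε : ℝ) (sf : Literature.Geometry.Kaehler.MForm (𝓡 4) (punctured p) ℝ 2),
    IsSymplecticStandardNearPoint p ε sf →
      ∃ φ : 𝕊³ ≃ₘ⟮𝓡 3, 𝓡 3⟯ 𝕊³, Literature.Topology.FourManifolds.IsTwistedSphere 3 φ S.carrier

namespace gromovMcDuff_isTwistedSphere_of_symplecticStandardNearPoint

variable [Fact (Literature.Topology.FourManifolds.isSmoothEmbedding_sphereInclusion' 3)]

/-- Under the fact, a homotopy 4-sphere carrying a symplectic form standard near a puncture
inhabits `Literature.TwistedSphere 3 φ` for some `φ` (bundling `S.carrier` with the gluing proof).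
[folklore] -/
theorem exists_twistedSphere (h : gromovMcDuff_isTwistedSphere_of_symplecticStandardNearPoint)
    (S : Literature.Topology.FourManifolds.HomotopySphere 4) (p : S.carrier) (ε : ℝ) (sf : Literature.Geometry.Kaehler.MForm (𝓡 4) (punctured p) ℝ 2)
    (hs : IsSymplecticStandardNearPoint p ε sf) :
    ∃ (φ : 𝕊³ ≃ₘ⟮𝓡 3, 𝓡 3⟯ 𝕊³) (T : Literature.Topology.FourManifolds.TwistedSphere 3 φ), T.carrier = S.carrier := by
  obtain ⟨φ, hφ⟩ := h S p ε sf hs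
  exact ⟨φ, { carrier := S.carrier, isTwistedSphere := hφ }, rfl⟩

/-- **The route's fallback assembly (R7 → Cerf).** Under the Gromov–McDuff fact and Cerf's
`Γ₄ = 0` in twisted-sphere form (`Literature.Topology.FourManifolds.cerf_twistedSphere_four`), a homotopy 4-sphere carrying a
symplectic form on `Σ ∖ p` standard near `p` is diffeomorphic to `S⁴`. [folklore] -/
theorem nonempty_diffeomorph_sphere
    (h : gromovMcDuff_isTwistedSphere_of_symplecticStandardNearPoint)
    (hC : Literature.Topology.FourManifolds.cerf_twistedSphere_four) (S : Literature.Topology.FourManifolds.HomotopySphere 4) (p : S.carrier) (ε : ℝ)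
    (sf : Literature.Geometry.Kaehler.MForm (𝓡 4) (punctured p) ℝ 2) (hs : IsSymplecticStandardNearPoint p ε sf) :
    Nonempty (S.carrier ≃ₘ⟮𝓡 4, 𝓡 4⟯ 𝕊⁴) := by
  obtain ⟨φ, hφ⟩ := h S p ε sf hs
  exact hC φ { carrier := S.carrier, isTwistedSphere := hφ }

end gromovMcDuff_isTwistedSphere_of_symplecticStandardNearPoint

end Literature.Geometry.Symplectic

end
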